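import Summits.NavierStokesRegularity.JiaSverakCAP.GS17SpectrumAtZero
import HarnessLib

/-!
# GŠ17 Thm 2.1 (1) erratum witness, part 2: the VECTOR identity `𝓛(0)v = ½ v` for
# `v = ∇Φ × e₃`, `Φ(x) = erf(‖x‖/2)/‖x‖`, on `ℝ³ ∖ {0}` (`JiaSverakCAP.GS17SpectrumAtZeroVector`)

HONEST FRAMING (audit cell `pub-nsjs`; papers lane PF-P2 §9 E2). Pure calculus; asserts NOTHING about Navier–Stokes,
the cell's profile, its window eigenvalue or non-uniqueness, and discharges no paper-level hypothesis. It completes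
the kernel check of steps (ii)–(iii) of the erratum computation begun in `GS17SpectrumAtZero` (step (i)), in the
following concrete form. Since `∇Φ(x) = 2 g'(‖x‖²) x` for `Φ(x) = g(‖x‖²)`, every Cartesian component of
`v = ∇Φ × e₃ = 2 g'(‖x‖²) (x₂, −x₁, 0)` is (± ) a function `c_a(x) = 2 g'(‖x‖²) ⟪x, a⟫` with a fixed vector `a`
(`a = e₂`, `a = e₁`; the third component is `0`). For such components the scalar operator acts componentwise, and
`𝓛(0)v = ½v` (GŠ sign, zero pressure) is, component by component, the identity

  `−Δ c_a − ½ D c_a(x)[x] − ½ c_a = ½ c_a`  on `{x ≠ 0}`,   (V)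

which is what `swirlComp_eigen_identity` below proves for EVERY `a : EuclideanSpace ℝ (Fin 3)`; the zero third
component satisfies (V) trivially. Ingredients: the third radial derivative (`coulombGaussD3`,
`hasDerivAt_coulombGaussD2`), the `s = r²` bookkeeping (`coulombGaussSqD2_eq_radP`, `hasDerivAt_coulombGaussSqD2`),
the `s`-derivative of the scalar identity of part 1 (`radial_identity_deriv_s`), and a product-rule Laplacian for
`g(‖x‖²)·⟪x, a⟫` (`laplacian_comp_norm_sq_mul_inner`) proved like `RadialCalculus.laplacian_comp_norm_sq`.

STILL NOT checked (hand / function-space facts): `v ∈ 𝒟` (smoothness at `0`, `L² ∩ L⁴` decay), the reading of the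
printed operator, and the journal text of GŠ17 (arXiv:1704.00560v1 only was read).

## References
* J. Guillod, V. Šverák, arXiv:1704.00560v1 = J. Math. Fluid Mech. 25 (2023), Thm 2.1 (1). [GuillodSverak2023]
* Th. Gallay, C. E. Wayne, Arch. Ration. Mech. Anal. 163 (2002), Thm A.1. [GallayWayne2002]
-/

noncomputable section

open MeasureTheory Set Filter intervalIntegral InnerProductSpace
open _root_.Topology
open scoped RealInnerProductSpace Laplacian
open Literature.Analysis.FluidPDE

namespace Summit.NavierStokesRegularity.JiaSverakCAP.GS17SpectrumAtZero

/-! ### Part A — third radial derivative and the `s = r²` bookkeeping -/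

/-- `φ'''(r) = (r/4)E + E/r + 6E/r³ − 6w/r⁴` with `E = gaussHalf r`, `w = erfHalf r` (`r ≠ 0`). [folklore] -/
def coulombGaussD3 (r : ℝ) : ℝ :=
  r / 4 * gaussHalf r + gaussHalf r / r + 6 * gaussHalf r / r ^ 3 - 6 * erfHalf r / r ^ 4

/-- `coulombGaussD2' = coulombGaussD3` away from `0`. [folklore] -/
theorem hasDerivAt_coulombGaussD2 {r : ℝ} (hr : r ≠ 0) :
    HasDerivAt coulombGaussD2 (coulombGaussD3 r) r := by
  have hE := hasDerivAt_gaussHalf r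
  have hw := hasDerivAt_erfHalf r
  have h3 : HasDerivAt (fun u : ℝ => u ^ 3) ((3 : ℕ) * r ^ (3 - 1)) r := hasDerivAt_pow 3 r
  have h2 : HasDerivAt (fun u : ℝ => u ^ 2) ((2 : ℕ) * r ^ (2 - 1)) r := hasDerivAt_pow 2 r
  have hA : HasDerivAt (fun u : ℝ => -(gaussHalf u) / 2) (-(-(r / 2) * gaussHalf r) / 2) r :=
    hE.neg.div_const 2
  have hB : HasDerivAt (fun u : ℝ => 2 * gaussHalf u / u ^ 2)
      ((2 * (-(r / 2) * gaussHalf r) * r ^ 2 - 2 * gaussHalf r * ((2 : ℕ) * r ^ (2 - 1))) / (r ^ 2) ^ 2) r :=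
    (hE.const_mul 2).div h2 (pow_ne_zero 2 hr)
  have hC : HasDerivAt (fun u : ℝ => 2 * erfHalf u / u ^ 3)
      ((2 * gaussHalf r * r ^ 3 - 2 * erfHalf r * ((3 : ℕ) * r ^ (3 - 1))) / (r ^ 3) ^ 2) r :=
    (hw.const_mul 2).div h3 (pow_ne_zero 3 hr)
  have h := (hA.sub hB).add hC
  have h' : HasDerivAt coulombGaussD2
      (-(-(r / 2) * gaussHalf r) / 2 -
          (2 * (-(r / 2) * gaussHalf r) * r ^ 2 - 2 * gaussHalf r * ((2 : ℕ) * r ^ (2 - 1))) / (r ^ 2) ^ 2 +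
        (2 * gaussHalf r * r ^ 3 - 2 * erfHalf r * ((3 : ℕ) * r ^ (3 - 1))) / (r ^ 3) ^ 2) r := h
  refine h'.congr_deriv ?_
  simp only [coulombGaussD3, Nat.cast_ofNat]
  field_simp
  ring

/-- The `r`-form of `coulombGaussSqD2`: `P(r) = φ''(r)/(4r²) − φ'(r)/(4r³)`. [folklore] -/
def radP (r : ℝ) : ℝ :=
  coulombGaussD2 r / (4 * r ^ 2) - coulombGaussD1 r / (4 * r ^ 3)

/-- `P'(r) = φ'''/(4r²) − 3φ''/(4r³) + 3φ'/(4r⁴)`. [folklore] -/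
def radPD (r : ℝ) : ℝ :=
  coulombGaussD3 r / (4 * r ^ 2) - 3 * coulombGaussD2 r / (4 * r ^ 3) + 3 * coulombGaussD1 r / (4 * r ^ 4)

/-- `coulombGaussSqD2 s = P(√s)` for `s > 0`. [folklore] -/
theorem coulombGaussSqD2_eq_radP {s : ℝ} (hs : 0 < s) : coulombGaussSqD2 s = radP (Real.sqrt s) := by
  have hr : Real.sqrt s ≠ 0 := (Real.sqrt_pos.2 hs).ne'
  simp only [coulombGaussSqD2, radP]
  field_simp
  ring

/-- `radP' = radPD` away from `0`. [folklore] -/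
theorem hasDerivAt_radP {r : ℝ} (hr : r ≠ 0) : HasDerivAt radP (radPD r) r := by
  have h2 : HasDerivAt (fun u : ℝ => 4 * u ^ 2) (4 * ((2 : ℕ) * r ^ (2 - 1))) r :=
    (hasDerivAt_pow 2 r).const_mul 4
  have h3 : HasDerivAt (fun u : ℝ => 4 * u ^ 3) (4 * ((3 : ℕ) * r ^ (3 - 1))) r :=
    (hasDerivAt_pow 3 r).const_mul 4
  have hA : HasDerivAt (fun u : ℝ => coulombGaussD2 u / (4 * u ^ 2))
      ((coulombGaussD3 r * (4 * r ^ 2) - coulombGaussD2 r * (4 * ((2 : ℕ) * r ^ (2 - 1)))) / (4 * r ^ 2) ^ 2)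
      r :=
    (hasDerivAt_coulombGaussD2 hr).div h2 (mul_ne_zero four_ne_zero (pow_ne_zero 2 hr))
  have hB : HasDerivAt (fun u : ℝ => coulombGaussD1 u / (4 * u ^ 3))
      ((coulombGaussD2 r * (4 * r ^ 3) - coulombGaussD1 r * (4 * ((3 : ℕ) * r ^ (3 - 1)))) / (4 * r ^ 3) ^ 2)
      r :=
    (hasDerivAt_coulombGaussD1 hr).div h3 (mul_ne_zero four_ne_zero (pow_ne_zero 3 hr))
  have h := hA.sub hB
  have h' : HasDerivAt radP
      ((coulombGaussD3 r * (4 * r ^ 2) - coulombGaussD2 r * (4 * ((2 : ℕ) * r ^ (2 - 1)))) / (4 * r ^ 2) ^ 2 -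
        (coulombGaussD2 r * (4 * r ^ 3) - coulombGaussD1 r * (4 * ((3 : ℕ) * r ^ (3 - 1)))) / (4 * r ^ 3) ^ 2)
      r := h
  refine h'.congr_deriv ?_
  simp only [radPD, Nat.cast_ofNat]
  field_simp
  ring

/-- `g'''(s) := P'(√s)·(1/(2√s))` (`s > 0`). [folklore] -/
def coulombGaussSqD3 (s : ℝ) : ℝ :=
  radPD (Real.sqrt s) * (1 / (2 * Real.sqrt s))

/-- `coulombGaussSqD2' = coulombGaussSqD3` on `(0, ∞)`. [folklore] -/
theorem hasDerivAt_coulombGaussSqD2 {s : ℝ} (hs : 0 < s) :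
    HasDerivAt coulombGaussSqD2 (coulombGaussSqD3 s) s := by
  have hr : Real.sqrt s ≠ 0 := (Real.sqrt_pos.2 hs).ne'
  have h : HasDerivAt (fun u : ℝ => radP (Real.sqrt u)) (radPD (Real.sqrt s) * (1 / (2 * Real.sqrt s))) s :=
    (hasDerivAt_radP hr).comp s (Real.hasDerivAt_sqrt hs.ne')
  have heq : (fun u : ℝ => radP (Real.sqrt u)) =ᶠ[𝓝 s] coulombGaussSqD2 := by
    filter_upwards [isOpen_Ioi.mem_nhds hs] with u hu
    exact (coulombGaussSqD2_eq_radP hu).symm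
  exact h.congr_of_eventuallyEq heq.symm

/-- **The `s`-derivative of the scalar identity**: `4 s g''' + 10 g'' + s g'' + (3/2) g' = 0` on `(0, ∞)`
(`g(s) = φ(√s)`); this is `d/ds` of `4 s g'' + 6 g' + s g' + ½ g = 0`, the `s`-form of
`coulombGauss_radial_identity`. Proved directly from the closed forms. [folklore] -/
theorem radial_identity_deriv_s {s : ℝ} (hs : 0 < s) :
    4 * s * coulombGaussSqD3 s + 10 * coulombGaussSqD2 s + s * coulombGaussSqD2 s +
      3 / 2 * coulombGaussSqD1 s = 0 := by
  have hr : Real.sqrt s ≠ 0 := (Real.sqrt_pos.2 hs).ne'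
  have hss : Real.sqrt s ^ 2 = s := Real.sq_sqrt hs.le
  rw [coulombGaussSqD2_eq_radP hs]
  simp only [coulombGaussSqD3, coulombGaussSqD1, radP, radPD, coulombGaussD3, coulombGaussD2, coulombGaussD1]
  -- everything is a rational function of `√s` times `gaussHalf (√s)`, `erfHalf (√s)`; replace `s` by `(√s)²`
  set r := Real.sqrt s with hr_def
  rw [← hss]
  field_simp
  ring

/-! ### Part B — a product-rule Laplacian for `w ↦ g(‖w‖²)·⟪w, a⟫` (after `RadialCalculus`) -/

section ProductRule

variable {E : Type*} [NormedAddCommGroup E] [InnerProductSpace ℝ E]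

/-- `w ↦ ⟪w, a⟫` has derivative `innerSL ℝ a = ⟪a, ·⟫`. [folklore] -/
theorem hasFDerivAt_inner_left_const (a z : E) :
    HasFDerivAt (fun w : E => ⟪w, a⟫) (innerSL ℝ a : E →L[ℝ] ℝ) z := by
  refine ((innerSL ℝ a : E →L[ℝ] ℝ).hasFDerivAt).congr_of_eventuallyEq
    (Eventually.of_forall fun w => ?_)
  simp only [innerSL_apply_apply]
  exact real_inner_comm a w

/-- **First derivative of `g(‖·‖²)·⟪·, a⟫`.** [folklore] -/
theorem hasFDerivAt_comp_norm_sq_mul_inner {g : ℝ → ℝ} {g₁ : ℝ} {z : E}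
    (hg : HasDerivAt g g₁ (‖z‖ ^ 2)) (a : E) :
    HasFDerivAt (fun w : E => g (‖w‖ ^ 2) * ⟪w, a⟫)
      (g (‖z‖ ^ 2) • (innerSL ℝ a : E →L[ℝ] ℝ) +
        ⟪z, a⟫ • ((2 * g₁) • (innerSL ℝ z : E →L[ℝ] ℝ))) z :=
  (hasFDerivAt_comp_norm_sq hg).mul (hasFDerivAt_inner_left_const a z)

/-- `∂_u (g(‖·‖²)⟪·,a⟫)(z) = g(‖z‖²)⟪a,u⟫ + ⟪z,a⟫ · (2 g₁ ⟪z,u⟫)`. [folklore] -/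
theorem fderiv_comp_norm_sq_mul_inner_apply {g : ℝ → ℝ} {g₁ : ℝ} {z : E}
    (hg : HasDerivAt g g₁ (‖z‖ ^ 2)) (a u : E) :
    fderiv ℝ (fun w : E => g (‖w‖ ^ 2) * ⟪w, a⟫) z u =
      g (‖z‖ ^ 2) * ⟪a, u⟫ + ⟪z, a⟫ * (2 * g₁ * ⟪z, u⟫) := by
  rw [(hasFDerivAt_comp_norm_sq_mul_inner hg a).fderiv]
  simp

/-- **Second directional derivatives of `g(‖·‖²)·⟪·, a⟫`**: with `g' = g₁` near `‖z‖²` and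
`g₁'(‖z‖²) = g₂`, the map `w ↦ ∂_u(g(‖·‖²)⟪·,a⟫)(w)` has derivative
`(2g₁⟪a,u⟫ + 4g₂⟪z,a⟫⟪z,u⟫)⟪z,·⟫ + 2g₁⟪z,a⟫⟪u,·⟫ + 2g₁⟪z,u⟫⟪a,·⟫` at `z`. [folklore] -/
theorem hasFDerivAt_fderiv_comp_norm_sq_mul_inner_apply {g g₁ : ℝ → ℝ} {g₂ : ℝ} {U : Set ℝ}
    (hU : IsOpen U) (hg : ∀ σ ∈ U, HasDerivAt g (g₁ σ) σ) {z : E} (hz : ‖z‖ ^ 2 ∈ U)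
    (hg₁ : HasDerivAt g₁ g₂ (‖z‖ ^ 2)) (a u : E) :
    HasFDerivAt (fun w : E => fderiv ℝ (fun w : E => g (‖w‖ ^ 2) * ⟪w, a⟫) w u)
      ((⟪a, u⟫ * (2 * g₁ (‖z‖ ^ 2)) + ⟪z, a⟫ * (4 * g₂ * ⟪z, u⟫)) • (innerSL ℝ z : E →L[ℝ] ℝ) +
        (⟪z, a⟫ * (2 * g₁ (‖z‖ ^ 2))) • (innerSL ℝ u : E →L[ℝ] ℝ) +
        (2 * g₁ (‖z‖ ^ 2) * ⟪z, u⟫) • (innerSL ℝ a : E →L[ℝ] ℝ)) z := by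
  have hV : {w : E | ‖w‖ ^ 2 ∈ U} ∈ 𝓝 z :=
    (hU.preimage (continuous_norm.pow 2)).mem_nhds hz
  have heq : (fun w : E => g (‖w‖ ^ 2) * ⟪a, u⟫ + ⟪w, a⟫ * (2 * g₁ (‖w‖ ^ 2) * ⟪w, u⟫)) =ᶠ[𝓝 z]
      fun w => fderiv ℝ (fun w : E => g (‖w‖ ^ 2) * ⟪w, a⟫) w u := by
    filter_upwards [hV] with w hw
    exact (fderiv_comp_norm_sq_mul_inner_apply (hg _ hw) a u).symm
  refine HasFDerivAt.congr_of_eventuallyEq ?_ heq.symm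
  -- term 1: `w ↦ g(‖w‖²) * ⟪a,u⟫`
  have h1 : HasFDerivAt (fun w : E => g (‖w‖ ^ 2) * ⟪a, u⟫)
      (⟪a, u⟫ • ((2 * g₁ (‖z‖ ^ 2)) • (innerSL ℝ z : E →L[ℝ] ℝ))) z :=
    (hasFDerivAt_comp_norm_sq (hg _ hz)).mul_const _
  -- term 2: `w ↦ ⟪w,a⟫ * (2 g₁(‖w‖²) ⟪w,u⟫)`
  have hm1 : HasFDerivAt (fun w : E => 2 * g₁ (‖w‖ ^ 2))
      ((2 * (2 * g₂)) • (innerSL ℝ z : E →L[ℝ] ℝ)) z := by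
    have := (hasFDerivAt_comp_norm_sq (g := g₁) hg₁).const_mul 2
    refine this.congr_fderiv ?_
    rw [smul_smul]
  have hm : HasFDerivAt (fun w : E => 2 * g₁ (‖w‖ ^ 2) * ⟪w, u⟫)
      ((2 * g₁ (‖z‖ ^ 2)) • (innerSL ℝ u : E →L[ℝ] ℝ) +
        ⟪z, u⟫ • ((2 * (2 * g₂)) • (innerSL ℝ z : E →L[ℝ] ℝ))) z :=
    hm1.mul (hasFDerivAt_inner_left_const u z)
  have h2 : HasFDerivAt (fun w : E => ⟪w, a⟫ * (2 * g₁ (‖w‖ ^ 2) * ⟪w, u⟫))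
      (⟪z, a⟫ • ((2 * g₁ (‖z‖ ^ 2)) • (innerSL ℝ u : E →L[ℝ] ℝ) +
          ⟪z, u⟫ • ((2 * (2 * g₂)) • (innerSL ℝ z : E →L[ℝ] ℝ))) +
        (2 * g₁ (‖z‖ ^ 2) * ⟪z, u⟫) • (innerSL ℝ a : E →L[ℝ] ℝ)) z :=
    (hasFDerivAt_inner_left_const a z).mul hm
  refine (h1.add h2).congr_fderiv ?_
  ext v
  simp
  ring

/-- `∂_v ∂_u (g(‖·‖²)⟪·,a⟫)(z)` in closed form. [folklore] -/
theorem fderiv_fderiv_comp_norm_sq_mul_inner_apply {g g₁ : ℝ → ℝ} {g₂ : ℝ} {U : Set ℝ}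
    (hU : IsOpen U) (hg : ∀ σ ∈ U, HasDerivAt g (g₁ σ) σ) {z : E} (hz : ‖z‖ ^ 2 ∈ U)
    (hg₁ : HasDerivAt g₁ g₂ (‖z‖ ^ 2)) (a u v : E) :
    fderiv ℝ (fun w : E => fderiv ℝ (fun w : E => g (‖w‖ ^ 2) * ⟪w, a⟫) w u) z v =
      (⟪a, u⟫ * (2 * g₁ (‖z‖ ^ 2)) + ⟪z, a⟫ * (4 * g₂ * ⟪z, u⟫)) * ⟪z, v⟫ +
        ⟪z, a⟫ * (2 * g₁ (‖z‖ ^ 2)) * ⟪u, v⟫ + 2 * g₁ (‖z‖ ^ 2) * ⟪z, u⟫ * ⟪a, v⟫ := by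
  rw [(hasFDerivAt_fderiv_comp_norm_sq_mul_inner_apply hU hg hz hg₁ a u).fderiv]
  simp

/-- The derivative `w ↦ D(g(‖·‖²)⟪·,a⟫)(w)` is differentiable at `z` (as a map into `E →L[ℝ] ℝ`).
[folklore] -/
theorem differentiableAt_fderiv_comp_norm_sq_mul_inner {g g₁ : ℝ → ℝ} {g₂ : ℝ} {U : Set ℝ}
    (hU : IsOpen U) (hg : ∀ σ ∈ U, HasDerivAt g (g₁ σ) σ) {z : E} (hz : ‖z‖ ^ 2 ∈ U)
    (hg₁ : HasDerivAt g₁ g₂ (‖z‖ ^ 2)) (a : E) :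
    DifferentiableAt ℝ (fderiv ℝ (fun w : E => g (‖w‖ ^ 2) * ⟪w, a⟫)) z := by
  have hV : {w : E | ‖w‖ ^ 2 ∈ U} ∈ 𝓝 z :=
    (hU.preimage (continuous_norm.pow 2)).mem_nhds hz
  have heq : (fun w : E => g (‖w‖ ^ 2) • (innerSL ℝ a : E →L[ℝ] ℝ) +
      ⟪w, a⟫ • ((2 * g₁ (‖w‖ ^ 2)) • (innerSL ℝ w : E →L[ℝ] ℝ))) =ᶠ[𝓝 z]
      fderiv ℝ (fun w : E => g (‖w‖ ^ 2) * ⟪w, a⟫) := by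
    filter_upwards [hV] with w hw
    exact ((hasFDerivAt_comp_norm_sq_mul_inner (hg _ hw) a).fderiv).symm
  refine DifferentiableAt.congr_of_eventuallyEq ?_ heq.symm
  have d1 : DifferentiableAt ℝ (fun w : E => g (‖w‖ ^ 2)) z :=
    (hasFDerivAt_comp_norm_sq (hg _ hz)).differentiableAt
  have d2 : DifferentiableAt ℝ (fun w : E => ⟪w, a⟫) z :=
    (hasFDerivAt_inner_left_const a z).differentiableAt
  have d3 : DifferentiableAt ℝ (fun w : E => 2 * g₁ (‖w‖ ^ 2)) z :=
    ((hasFDerivAt_comp_norm_sq (g := g₁) hg₁).differentiableAt).const_mul 2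
  have d4 : DifferentiableAt ℝ (fun w : E => (innerSL ℝ w : E →L[ℝ] ℝ)) z :=
    (innerSL ℝ : E →L[ℝ] E →L[ℝ] ℝ).differentiableAt
  exact (d1.smul (differentiableAt_const _)).add (d2.smul (d3.smul d4))

/-- **Product-rule Laplacian**: `Δ(g(‖·‖²)⟪·,a⟫)(z) = (4 g₂ ‖z‖² + (2d + 4) g₁(‖z‖²)) ⟪z, a⟫`,
`d = dim E` — i.e. `ΔG·L + 2∇G·∇L` with `L = ⟪·,a⟫` harmonic, `G = g(‖·‖²)`. [folklore] -/
theorem laplacian_comp_norm_sq_mul_inner [FiniteDimensional ℝ E] {g g₁ : ℝ → ℝ} {g₂ : ℝ}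
    {U : Set ℝ} (hU : IsOpen U) (hg : ∀ σ ∈ U, HasDerivAt g (g₁ σ) σ) {z : E} (hz : ‖z‖ ^ 2 ∈ U)
    (hg₁ : HasDerivAt g₁ g₂ (‖z‖ ^ 2)) (a : E) :
    (Δ (fun w : E => g (‖w‖ ^ 2) * ⟪w, a⟫)) z =
      (4 * g₂ * ‖z‖ ^ 2 + (2 * (Module.finrank ℝ E) + 4) * g₁ (‖z‖ ^ 2)) * ⟪z, a⟫ := by
  set b := stdOrthonormalBasis ℝ E
  have hD := differentiableAt_fderiv_comp_norm_sq_mul_inner hU hg hz hg₁ a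
  have h1 : ∀ i, iteratedFDeriv ℝ 2 (fun w : E => g (‖w‖ ^ 2) * ⟪w, a⟫) z ![b i, b i] =
      (⟪a, b i⟫ * (2 * g₁ (‖z‖ ^ 2)) + ⟪z, a⟫ * (4 * g₂ * ⟪z, b i⟫)) * ⟪z, b i⟫ +
        ⟪z, a⟫ * (2 * g₁ (‖z‖ ^ 2)) * ⟪b i, b i⟫ + 2 * g₁ (‖z‖ ^ 2) * ⟪z, b i⟫ * ⟪a, b i⟫ :=
    fun i => by
    rw [iteratedFDeriv_two_apply, ← fderiv_fderiv_comp_norm_sq_mul_inner_apply hU hg hz hg₁ a (b i) (b i),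
      fderiv_clm_apply hD (differentiableAt_const _)]
    simp
  rw [congrFun (laplacian_eq_iteratedFDeriv_orthonormalBasis (fun w : E => g (‖w‖ ^ 2) * ⟪w, a⟫) b) z]
  simp_rw [h1]
  have S1 : ∑ i, ⟪a, b i⟫ * ⟪b i, z⟫ = ⟪a, z⟫ := b.sum_inner_mul_inner a z
  have S2 : ∑ i, ⟪z, b i⟫ * ⟪b i, z⟫ = ⟪z, z⟫ := b.sum_inner_mul_inner z z
  have S3 : ∑ i, ⟪z, b i⟫ * ⟪b i, a⟫ = ⟪z, a⟫ := b.sum_inner_mul_inner z a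
  have S4 : ∑ i, ⟪b i, b i⟫ = (Module.finrank ℝ E : ℝ) := by
    simp_rw [real_inner_self_eq_norm_sq, b.orthonormal.1, one_pow, Finset.sum_const,
      Finset.card_univ, Fintype.card_fin, nsmul_eq_mul, mul_one]
  have hsum : ∀ i, (⟪a, b i⟫ * (2 * g₁ (‖z‖ ^ 2)) + ⟪z, a⟫ * (4 * g₂ * ⟪z, b i⟫)) * ⟪z, b i⟫ +
        ⟪z, a⟫ * (2 * g₁ (‖z‖ ^ 2)) * ⟪b i, b i⟫ + 2 * g₁ (‖z‖ ^ 2) * ⟪z, b i⟫ * ⟪a, b i⟫ =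
      (2 * g₁ (‖z‖ ^ 2)) * (⟪a, b i⟫ * ⟪b i, z⟫) + (⟪z, a⟫ * (4 * g₂)) * (⟪z, b i⟫ * ⟪b i, z⟫) +
        (⟪z, a⟫ * (2 * g₁ (‖z‖ ^ 2))) * ⟪b i, b i⟫ + (2 * g₁ (‖z‖ ^ 2)) * (⟪z, b i⟫ * ⟪b i, a⟫) :=
    fun i => by
    rw [real_inner_comm z (b i), real_inner_comm a (b i)]
    ring
  simp_rw [hsum]
  rw [Finset.sum_add_distrib, Finset.sum_add_distrib, Finset.sum_add_distrib, ← Finset.mul_sum,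
    ← Finset.mul_sum, ← Finset.mul_sum, ← Finset.mul_sum, S1, S2, S3, S4, real_inner_self_eq_norm_sq,
    real_inner_comm z a]
  ring

end ProductRule

/-! ### Part C — the vector identity, componentwise: `𝓛(0)v = ½v` for `v = ∇Φ × e₃` on `ℝ³ ∖ {0}` -/

/-- A Cartesian component of `v = ∇Φ × e₃` (up to sign): `c_a(x) = 2 g'(‖x‖²) ⟪x, a⟫` with
`g = coulombGaussSq` (`∇Φ(x) = 2 g'(‖x‖²) x`; take `a = e₂` for `v₁`, `a = e₁` for `−v₂`; `v₃ = 0`).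
[folklore] -/
def swirlComp (a : EuclideanSpace ℝ (Fin 3)) (x : EuclideanSpace ℝ (Fin 3)) : ℝ :=
  2 * coulombGaussSqD1 (‖x‖ ^ 2) * ⟪x, a⟫

/-- **Steps (ii)–(iii), kernel-checked**: for every `a` and every `x ≠ 0`,
`−Δ c_a(x) − ½ Dc_a(x)[x] − ½ c_a(x) = ½ c_a(x)`, i.e. each component of `v = ∇Φ × e₃`
(`Φ(x) = erf(‖x‖/2)/‖x‖`) is an eigenfunction of Guillod–Šverák's scalar operator `−Δ − ½x·∇ − ½` with
eigenvalue `½` on `ℝ³ ∖ {0}` — so `𝓛(0)v = ½v` there (the pressure term is absent: for `U = 0` and a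
divergence-free `v`, `−Δv − ½x·∇v − ½v` is divergence-free). Together with part 1 this kernel-checks the whole
closed-form computation of the erratum; what remains by hand is `v ∈ 𝒟` and the reading of the printed operator
(arXiv:1704.00560v1 only). [folklore] -/
theorem swirlComp_eigen_identity (a : EuclideanSpace ℝ (Fin 3)) {x : EuclideanSpace ℝ (Fin 3)}
    (hx : x ≠ 0) :
    -(Δ (swirlComp a)) x - 1 / 2 * fderiv ℝ (swirlComp a) x x - 1 / 2 * swirlComp a x =
      1 / 2 * swirlComp a x := by
  have hs : 0 < ‖x‖ ^ 2 := by positivity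
  -- the radial data: g = 2·SqD1, g₁ = 2·SqD2 on (0,∞), g₂ = 2·SqD3(‖x‖²)
  have hg : ∀ σ ∈ Ioi (0 : ℝ), HasDerivAt (fun s : ℝ => 2 * coulombGaussSqD1 s)
      ((fun s : ℝ => 2 * coulombGaussSqD2 s) σ) σ :=
    fun σ hσ => (hasDerivAt_coulombGaussSqD1 hσ).const_mul 2
  have hg₁ : HasDerivAt (fun s : ℝ => 2 * coulombGaussSqD2 s) (2 * coulombGaussSqD3 (‖x‖ ^ 2))
      (‖x‖ ^ 2) :=
    (hasDerivAt_coulombGaussSqD2 hs).const_mul 2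
  have hΔ := laplacian_comp_norm_sq_mul_inner (E := EuclideanSpace ℝ (Fin 3)) isOpen_Ioi hg (z := x) hs
    hg₁ a
  have hD := fderiv_comp_norm_sq_mul_inner_apply (E := EuclideanSpace ℝ (Fin 3)) (hg _ hs) a x
  have h3 : Module.finrank ℝ (EuclideanSpace ℝ (Fin 3)) = 3 := by simp
  change -(Δ (fun w : EuclideanSpace ℝ (Fin 3) => 2 * coulombGaussSqD1 (‖w‖ ^ 2) * ⟪w, a⟫)) x
      - 1 / 2 * fderiv ℝ (fun w : EuclideanSpace ℝ (Fin 3) => 2 * coulombGaussSqD1 (‖w‖ ^ 2) * ⟪w, a⟫) x x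
      - 1 / 2 * (2 * coulombGaussSqD1 (‖x‖ ^ 2) * ⟪x, a⟫)
      = 1 / 2 * (2 * coulombGaussSqD1 (‖x‖ ^ 2) * ⟪x, a⟫)
  rw [hΔ, hD, h3, real_inner_self_eq_norm_sq, real_inner_comm x a]
  have hid := radial_identity_deriv_s hs
  push_cast
  linear_combination (-2 * ⟪x, a⟫) * hid

end Summit.NavierStokesRegularity.JiaSverakCAP.GS17SpectrumAtZero
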